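import Mathlib
import Literature.Probability.RandomGraphs.LowDegree
import HarnessLib

/-!
# Crux `MobiusLadder.LiouvilleOrthogonalTC0` (stmt-QuantumAdvantage-1393), line `Sketch`, skeleton v8:
stub `stub_symmetricRung` (lead) — the symmetric-digital rung from its three inputs

Line `Sketch`, skeleton v8 (lead `prover-line-stmt-QuantumAdvantage-1393-c5-0`). The v8 rung: `λ` is
asymptotically orthogonal to EVERY Boolean function of the Hamming weight `s₂(N)` of the binary digits,
assembled from three inputs on the Gelfond sums `S_n(α) = Σ_{N<2ⁿ} λ(N) e(α s₂(N))`: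
* `hSmall` — small frequencies `|α| ≤ n^{a−1/2}` (PROVED: `stub_gelfondSmall_of_tail` ∘ `stub_phaseTail`,
  from the tree's proved `WalshLiouvilleBound`);
* `hLarge` — LARGE frequencies `n^{a−1/2} ≤ |α| ≤ 1/2`: the analytic HYPOTHESIS `GelfondLiouvilleDecay`
  (Mauduit–Rivat type; in print for `Λ` and `μ`, not for `λ`; never asserted here);
* `hCrit` — the slice criterion (PROVED: `stub_sliceCriterion_of` ∘ `stub_sliceL2`, `stub_sliceTail`).
The proof is bookkeeping: at the frequency `k/(n+1)` (`k ≤ n`) use `hSmall`/`hLarge` with `B = 1`, at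
`k/(n+1)` itself when it is `≤ 1/2` and at `k/(n+1) − 1 ∈ (−1/2, 0)` otherwise (`S_n` is `1`-periodic in
`α` because `s₂(N)` is an integer), then feed the uniform bound `2ⁿ/n` to `hCrit` with `G' = sgn ∘ G`.
-/

set_option linter.dupNamespace false -- D-0017: single-problem summit ⇒ `QuantumAdvantage.QuantumAdvantage` by design

noncomputable section

namespace Summit.QuantumAdvantage.QuantumAdvantage.Theorems.LiouvilleOrthogonalTC0

open Filter Finset
open Literature.Probability.RandomGraphs.LowDegree (sgn)

/-- `1`-periodicity of the Gelfond phase in the frequency: for a natural weight `w`,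
`e((α − 1) w) = e(α w)`. -/
theorem symmRung_phase_sub_one (α : ℝ) (w : ℕ) :
    Complex.exp (((2 * Real.pi * (α - 1) * (w : ℝ) : ℝ) : ℂ) * Complex.I) =
      Complex.exp (((2 * Real.pi * α * (w : ℝ) : ℝ) : ℂ) * Complex.I) := by
  have h : ((2 * Real.pi * (α - 1) * (w : ℝ) : ℝ) : ℂ) * Complex.I =
      ((2 * Real.pi * α * (w : ℝ) : ℝ) : ℂ) * Complex.I - (w : ℂ) * (2 * Real.pi * Complex.I) := by
    push_cast; ring
  rw [h, Complex.exp_sub, Complex.exp_nat_mul_two_pi_mul_I, div_one]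

/-- **Stub `stub_symmetricRung` (line `Sketch`, v8, lead).** From the small-frequency bound `hSmall`,
the large-frequency hypothesis `hLarge` (= `GelfondLiouvilleDecay`) and the slice criterion `hCrit`:
for every `ε > 0`, eventually in `n`, `|Σ_{N<2ⁿ} λ(N)·sgn G(s₂(N))| ≤ ε·2ⁿ` for ALL `G : ℕ → Bool`. -/
theorem stub_symmetricRung
    (hSmall : ∃ a : ℝ, 0 < a ∧ ∀ B : ℕ, ∀ᶠ n : ℕ in atTop, ∀ α : ℝ, |α| ≤ (n : ℝ) ^ (a - 1 / 2) →
      ‖∑ N ∈ Finset.range (2 ^ n), ((ArithmeticFunction.liouville N : ℤ) : ℂ) *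
            Complex.exp (((2 * Real.pi * α *
              ((Finset.univ.filter fun i : Fin n => Nat.testBit N i = true).card : ℝ) : ℝ) : ℂ) * Complex.I)‖ ≤ (2 : ℝ) ^ n / (n : ℝ) ^ B)
    (hLarge : ∀ a : ℝ, 0 < a → ∀ B : ℕ, ∀ᶠ n : ℕ in atTop, ∀ α : ℝ,
      (n : ℝ) ^ (a - 1 / 2) ≤ |α| → |α| ≤ 1 / 2 →
        ‖∑ N ∈ Finset.range (2 ^ n), ((ArithmeticFunction.liouville N : ℤ) : ℂ) *
            Complex.exp (((2 * Real.pi * α *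
              ((Finset.univ.filter fun i : Fin n => Nat.testBit N i = true).card : ℝ) : ℝ) : ℂ) * Complex.I)‖ ≤ (2 : ℝ) ^ n / (n : ℝ) ^ B)
    (hCrit : ∀ ε : ℝ, 0 < ε → ∀ᶠ n : ℕ in atTop,
      (∀ k ∈ Finset.range (n + 1),
        ‖∑ N ∈ Finset.range (2 ^ n), ((ArithmeticFunction.liouville N : ℤ) : ℂ) *
            Complex.exp (((2 * Real.pi * ((k : ℝ) / (n + 1)) *
              ((Finset.univ.filter fun i : Fin n => Nat.testBit N i = true).card : ℝ) : ℝ) : ℂ) * Complex.I)‖ ≤ (2 : ℝ) ^ n / n) →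
      ∀ G : ℕ → ℝ, (∀ j, |G j| ≤ 1) →
        |∑ N ∈ Finset.range (2 ^ n), ((ArithmeticFunction.liouville N : ℤ) : ℝ) *
            G (Finset.univ.filter fun i : Fin n => Nat.testBit N i = true).card| ≤ ε * (2 : ℝ) ^ n) :
    ∀ ε : ℝ, 0 < ε → ∀ᶠ n : ℕ in atTop, ∀ G : ℕ → Bool,
      |∑ N ∈ Finset.range (2 ^ n), ((ArithmeticFunction.liouville N : ℤ) : ℝ) *
          sgn (G (Finset.univ.filter fun i : Fin n => Nat.testBit N i = true).card)| ≤ ε * (2 : ℝ) ^ n := by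
  intro ε hε
  obtain ⟨a, ha, hS⟩ := hSmall
  filter_upwards [hS 1, hLarge a ha 1, hCrit ε hε] with n hSn hLn hCn G
  -- the uniform bound at the `n + 1` frequencies `k/(n+1)`
  have key : ∀ k ∈ Finset.range (n + 1),
      ‖∑ N ∈ Finset.range (2 ^ n), ((ArithmeticFunction.liouville N : ℤ) : ℂ) *
          Complex.exp (((2 * Real.pi * ((k : ℝ) / (n + 1)) *
            ((Finset.univ.filter fun i : Fin n => Nat.testBit N i = true).card : ℝ) : ℝ) : ℂ) * Complex.I)‖
        ≤ (2 : ℝ) ^ n / n := by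
    intro k hk
    have hk' : (k : ℝ) < n + 1 := by
      have := Finset.mem_range.1 hk; exact_mod_cast this
    have hn1 : (0 : ℝ) < n + 1 := by positivity
    have hθ0 : 0 ≤ (k : ℝ) / (n + 1) := by positivity
    have hθ1 : (k : ℝ) / (n + 1) < 1 := by rw [div_lt_one hn1]; exact hk'
    by_cases hθ : (k : ℝ) / (n + 1) ≤ 1 / 2
    · by_cases hsm : |(k : ℝ) / (n + 1)| ≤ (n : ℝ) ^ (a - 1 / 2)
      · simpa only [pow_one] using hSn _ hsm
      · have h2 : |(k : ℝ) / (n + 1)| ≤ 1 / 2 := by rwa [abs_of_nonneg hθ0]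
        simpa only [pow_one] using hLn _ (le_of_lt (not_le.mp hsm)) h2
    · -- pass to the frequency `k/(n+1) - 1 ∈ (-1/2, 0)`
      have hper : ∀ N ∈ Finset.range (2 ^ n), ((ArithmeticFunction.liouville N : ℤ) : ℂ) *
          Complex.exp (((2 * Real.pi * ((k : ℝ) / (n + 1) - 1) *
            ((Finset.univ.filter fun i : Fin n => Nat.testBit N i = true).card : ℝ) : ℝ) : ℂ) * Complex.I) =
          ((ArithmeticFunction.liouville N : ℤ) : ℂ) *
          Complex.exp (((2 * Real.pi * ((k : ℝ) / (n + 1)) *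
            ((Finset.univ.filter fun i : Fin n => Nat.testBit N i = true).card : ℝ) : ℝ) : ℂ) * Complex.I) := by
        intro N _
        rw [symmRung_phase_sub_one]
      rw [← Finset.sum_congr rfl hper]
      have hθ' : |(k : ℝ) / (n + 1) - 1| ≤ 1 / 2 := by
        rw [abs_le]; constructor <;> linarith [not_le.mp hθ]
      by_cases hsm : |(k : ℝ) / (n + 1) - 1| ≤ (n : ℝ) ^ (a - 1 / 2)
      · simpa only [pow_one] using hSn _ hsm
      · simpa only [pow_one] using hLn _ (le_of_lt (not_le.mp hsm)) hθ'
  exact hCn key (fun j => sgn (G j)) (fun j => by cases G j <;> simp [sgn])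

end Summit.QuantumAdvantage.QuantumAdvantage.Theorems.LiouvilleOrthogonalTC0
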